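import Summits.QuantumFields.BalabanUV.T4Continuum.Support.ScalarCovariantGreenDecay

/-!
# T⁴ programme, SUBSTRATE (shared lattice-gauge analysis library) — THE QUADRATIC RATE: `Jcov κ ≤ C₂·κ²` on `[0,1]` and the admissible rate
# `κ_U′ = min 1 √(γ_U ∕ (2(C₂+1)))` of order `√γ_U` (vs. file 1's `κ_U` of order `γ_U`), with the entry decay of `S_U⁻¹` at the new rate
# (additive follower of `ScalarCovariantCoercive` ∕ `ScalarCovariantGreenDecay`; XREAD INFO I2 of ne5-leaf-02-g9, journal l.13242 — TAKEN)

Substrate cell `b2b-balaban-substrate-*`, seat p3.  File 1's row-defect budget `Jcov co d a′ α τ κ = co·(d(1+α)·κ²e^{κ²/2} + a′(1+τ)²(cosh κ − 1))`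
is QUADRATIC at small `κ`, but its admissible rate `kappaU` was chosen through the LINEAR bound `Jcov_le_linear`, giving `κ_U = O(γ_U)`.  THIS FILE:
 * **`Jcov_le_quadratic`**: for `0 ≤ κ ≤ 1`, `Jcov κ ≤ C₂·κ²` with **`C2 co d a′ α τ = co·e^{1/2}·(d(1+α) + a′(1+τ)²/2)`** (`κ²e^{κ²/2} ≤ e^{1/2}κ²`,
   `cosh κ − 1 ≤ (κ²/2)e^{κ²/2} ≤ (e^{1/2}/2)κ²` by `DeltaACombesThomas.sq_mul_cosh_div_sub_one_le` at `n = 1`);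
 * **`kappaU2 co d a′ α τ = min 1 √(γ_U ∕ (2(C₂ + 1)))`** (the `+1` only keeps the denominator positive when `co = 0`), `kappaU2_pos`,
   `kappaU2_nonneg_le_one`, and **`Jcov_kappaU2_le`**: `Jcov κ_U′ ≤ γ_U/2` — so every consumer of file 1–3's `(κ_U, γ_U/2)` may use `(κ_U′, γ_U/2)`;
 * **`scalarOp_inv_entry_decay_explicit2`**: `‖S_U⁻¹((x,α),(x′,α′))‖ ≤ (2/γ_U)·e^{−κ_U′·dist_∞(x,x′)/n}` (file 3's `scalarOp_inv_entry_decay` at the new rate).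
Numerically (reader's example `d = 4`, `card o = 4`, `a′ = 1`, `α = τ = 0`): `γ_U ≈ 1.5·10⁻²`, `κ_U ≈ 2·10⁻⁴`, `κ_U′ ≈ 1.6·10⁻²`.  Level-freeness unaffected.

HONEST FRAMING (T4-DAG p. 1).  MODEL level, constants OURS ([folklore] Combes–Thomas bookkeeping); NOT [B9] Thm 3.1 as printed; nothing printed
is a hypothesis; no `def … : Prop`; spine 0/9 unchanged; NOT infinite volume ∕ mass gap ∕ Clay.  HONEST DEPENDENCY: continuum YM on T⁴ ⇐ BetaPertH ∧
nine spine estimates (0/9 proved); BetaPertH ⇐ (D1) ∧ (D4) ∧ CAP+tail; G-an2-4 gates asym, D1 and NE2/3/4.  ABSOLUTE RULE kept; no `sorry`.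
-/

noncomputable section

open scoped BigOperators ComplexConjugate Matrix Matrix.Norms.L2Operator Kronecker ComplexOrder

namespace Summit.QuantumFields.BalabanUV.T4Continuum.ScalarCovariantRate

open Literature.MathematicalPhysics.QuantumFieldTheory.Balaban1983to89.B5Prop11Plancherel (Tor fine unitVec)
open Literature.MathematicalPhysics.QuantumFieldTheory.Balaban1983to89.Beta.DeltaACombesThomas (sq_mul_cosh_div_sub_one_le)
open Literature.MathematicalPhysics.QuantumFieldTheory.Balaban1983to89.Beta.TorusG0Decay (ldist)
open Summit.QuantumFields.BalabanUV.T4Continuum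
open Summit.QuantumFields.BalabanUV.T4Continuum.ScalarCovariantLaplacian
open Summit.QuantumFields.BalabanUV.T4Continuum.ScalarCovariantCoercive
open Summit.QuantumFields.BalabanUV.T4Continuum.ScalarCovariantGreenDecay

/-! ## §1 The quadratic bound of the row-defect budget -/

section Constants

/-- the quadratic constant **`C₂ = co·e^{1/2}·(d(1+α) + a′(1+τ)²/2)`**. [folklore] -/
def C2 (co d : ℕ) (a' α τ : ℝ) : ℝ := co * Real.exp (1 / 2) * (d * (1 + α) + a' * (1 + τ) ^ 2 / 2)

/-- `C₂ ≥ 0`. [folklore] -/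
theorem C2_nonneg (co d : ℕ) {a' α τ : ℝ} (ha' : 0 ≤ a') (hα : 0 ≤ α) : 0 ≤ C2 co d a' α τ := by unfold C2; positivity

/-- **`Jcov κ ≤ C₂·κ²` for `0 ≤ κ ≤ 1`**. [folklore] -/
theorem Jcov_le_quadratic (co d : ℕ) {a' α τ : ℝ} (ha' : 0 ≤ a') (hα : 0 ≤ α) {κ : ℝ} (hκ0 : 0 ≤ κ) (hκ1 : κ ≤ 1) :
    Jcov co d a' α τ κ ≤ C2 co d a' α τ * κ ^ 2 := by
  -- `e^{κ²/2} ≤ e^{1/2}`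
  have hexp : Real.exp (κ ^ 2 / 2) ≤ Real.exp (1 / 2) := Real.exp_le_exp.mpr (by nlinarith)
  have hA : κ ^ 2 * Real.exp (κ ^ 2 / 2) ≤ Real.exp (1 / 2) * κ ^ 2 := by
    rw [mul_comm]; exact mul_le_mul_of_nonneg_right hexp (sq_nonneg κ)
  -- `cosh κ − 1 ≤ (κ²/2)e^{κ²/2} ≤ (e^{1/2}/2)κ²`
  have hB : Real.cosh κ - 1 ≤ Real.exp (1 / 2) / 2 * κ ^ 2 := by
    have h := sq_mul_cosh_div_sub_one_le (n := 1) κ le_rfl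
    simp only [Nat.cast_one, one_pow, one_mul, div_one] at h
    calc Real.cosh κ - 1 ≤ κ ^ 2 / 2 * Real.exp (κ ^ 2 / 2) := h
      _ ≤ κ ^ 2 / 2 * Real.exp (1 / 2) := mul_le_mul_of_nonneg_left hexp (by positivity)
      _ = Real.exp (1 / 2) / 2 * κ ^ 2 := by ring
  unfold Jcov C2
  rw [show (co : ℝ) * Real.exp (1 / 2) * (d * (1 + α) + a' * (1 + τ) ^ 2 / 2) * κ ^ 2
      = co * (d * (1 + α) * (Real.exp (1 / 2) * κ ^ 2) + a' * (1 + τ) ^ 2 * (Real.exp (1 / 2) / 2 * κ ^ 2)) by ring]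
  refine mul_le_mul_of_nonneg_left (add_le_add ?_ ?_) (Nat.cast_nonneg _)
  · exact mul_le_mul_of_nonneg_left hA (by positivity)
  · exact mul_le_mul_of_nonneg_left hB (by positivity)

/-- the SQUARE-ROOT admissible rate **`κ_U′ = min 1 √(γ_U ∕ (2(C₂ + 1)))`**. [folklore] -/
def kappaU2 (co d : ℕ) (a' α τ : ℝ) : ℝ := min 1 (Real.sqrt (gammaU d a' α τ / (2 * (C2 co d a' α τ + 1))))

/-- `0 < κ_U′` when `γ_U > 0`. [folklore] -/
theorem kappaU2_pos (co d : ℕ) {a' α τ : ℝ} (ha' : 0 ≤ a') (hα : 0 ≤ α) (hγ : 0 < gammaU d a' α τ) : 0 < kappaU2 co d a' α τ := by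
  have hC := C2_nonneg co d ha' hα (τ := τ)
  unfold kappaU2
  exact lt_min zero_lt_one (Real.sqrt_pos.mpr (div_pos hγ (by positivity)))

/-- `0 ≤ κ_U′ ≤ 1`. [folklore] -/
theorem kappaU2_nonneg_le_one (co d : ℕ) (a' α τ : ℝ) : 0 ≤ kappaU2 co d a' α τ ∧ kappaU2 co d a' α τ ≤ 1 :=
  ⟨le_min zero_le_one (Real.sqrt_nonneg _), min_le_left _ _⟩

/-- **the new rate is admissible**: `Jcov κ_U′ ≤ γ_U/2`. [folklore] -/
theorem Jcov_kappaU2_le (co d : ℕ) {a' α τ : ℝ} (ha' : 0 ≤ a') (hα : 0 ≤ α) (hγ : 0 < gammaU d a' α τ) :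
    Jcov co d a' α τ (kappaU2 co d a' α τ) ≤ gammaU d a' α τ / 2 := by
  set C : ℝ := C2 co d a' α τ with hCdef
  have hC : 0 ≤ C := C2_nonneg co d ha' hα
  have hk := kappaU2_nonneg_le_one co d a' α τ
  refine (Jcov_le_quadratic co d ha' hα hk.1 hk.2).trans ?_
  rw [← hCdef]
  have hsq : kappaU2 co d a' α τ ^ 2 ≤ gammaU d a' α τ / (2 * (C + 1)) := by
    have h1 : kappaU2 co d a' α τ ≤ Real.sqrt (gammaU d a' α τ / (2 * (C + 1))) := min_le_right _ _
    calc kappaU2 co d a' α τ ^ 2 ≤ Real.sqrt (gammaU d a' α τ / (2 * (C + 1))) ^ 2 := pow_le_pow_left₀ hk.1 h1 2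
      _ = gammaU d a' α τ / (2 * (C + 1)) := Real.sq_sqrt (by positivity)
  calc C * kappaU2 co d a' α τ ^ 2 ≤ C * (gammaU d a' α τ / (2 * (C + 1))) := mul_le_mul_of_nonneg_left hsq hC
    _ = gammaU d a' α τ / 2 * (C / (C + 1)) := by field_simp
    _ ≤ gammaU d a' α τ / 2 * 1 := mul_le_mul_of_nonneg_left ((div_le_one (by positivity)).mpr (by linarith)) (by positivity)
    _ = gammaU d a' α τ / 2 := mul_one _

end Constants

/-! ## §2 The entry decay of `S_U⁻¹` at the square-root rate -/

section Entry

variable {d : ℕ} {o : Type*} [Fintype o] [DecidableEq o]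
variable (n : ℕ) [NeZero n] (M : Fin d → ℕ) [hM : ∀ μ, NeZero (M μ)]
variable {a' : ℝ} {R : Fin d → (Tor (fine n M) → Matrix o o ℂ)} {T : Tor (fine n M) → Matrix o o ℂ} {α τ : ℝ}

/-- **THE ENTRY DECAY AT THE SQUARE-ROOT RATE**: `‖S_U⁻¹((x,α),(x′,α′))‖ ≤ (2/γ_U)·e^{−κ_U′·dist_∞(x,x′)/n}`, `κ_U′ = kappaU2 (card o) d a′ α τ`,
for every level `n` and every torus with `n·M_μ ≥ 2`, under the small-field hypotheses of file 1. [folklore] -/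
theorem scalarOp_inv_entry_decay_explicit2 (ha' : 0 < a') (hα : 0 ≤ α) (hτ : 0 ≤ τ) (h2 : ∀ μ, 2 ≤ fine n M μ)
    (hR : ∀ μ x, ‖connS (fine n M) ((n : ℕ) : ℂ) R μ x‖ ≤ α) (hT : ∀ x, ‖T x - 1‖ ≤ τ) (hγ : 0 < gammaU d a' α τ)
    (e e' : Tor (fine n M) × o) :
    ‖(scalarOp n M a' R T)⁻¹ e e'‖
      ≤ 2 / gammaU d a' α τ * Real.exp (-(kappaU2 (Fintype.card o) d a' α τ * (ldist (fine n M) e.1 e'.1 / n))) := by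
  have hJ := Jcov_kappaU2_le (Fintype.card o) d ha'.le hα hγ (τ := τ)
  have hJ' : Jcov (Fintype.card o) d a' α τ (kappaU2 (Fintype.card o) d a' α τ) < gammaU d a' α τ := by linarith
  refine (scalarOp_inv_entry_decay n M ha' hα hτ h2 hR hT (kappaU2_nonneg_le_one _ d a' α τ).1 hJ' e e').trans ?_
  rw [div_eq_mul_inv, mul_comm]
  refine mul_le_mul_of_nonneg_right ?_ (Real.exp_pos _).le
  rw [div_eq_mul_inv, show (2 : ℝ) * (gammaU d a' α τ)⁻¹ = (gammaU d a' α τ / 2)⁻¹ by rw [inv_div]; ring]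
  exact inv_anti₀ (by linarith) (by linarith)

end Entry

end Summit.QuantumFields.BalabanUV.T4Continuum.ScalarCovariantRate

end
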